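import Summits.Ventures.HodgeRepro2.T5BergmanCoefficientLpNorm
import Summits.Ventures.HodgeRepro2.T5BergmanSchurHaar

/-!
# `L^p` membership of ALL matrix coefficients for `p ≥ 2`; `L^p` norm bounds for the `K`-finite ones

Two complements to the `L^p` thresholds of `T5BergmanCoefficientLp` / `T5BergmanCoefficientLpNorm`.

* For ARBITRARY holomorphic `f, h ∈ A_k` (`k ≥ 2`) the coefficient `g ↦ ⟨π_k(g) f, h⟩_k` is bounded by
  `√(⟨f,f⟩_k ⟨h,h⟩_k)` and square-integrable (the Schur relations), hence lies in `L^p(SU(1,1), μ)` for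
  EVERY real `p ≥ 2` and every Haar measure `μ` (`memLp_matrixCoeff_of_two_le`: a bounded `L²`
  function is `L^p` for `p ≥ 2` — `integrable_norm_rpow_of_bounded_of_sq`), and likewise on
  `H_j = U(1,1)` (`memLp_matrixCoeffU_of_two_le`). Below `p = 2` the `K`-finite thresholds
  `k p > 2` of `T5BergmanCoefficientLp` are the sharp statement; for general vectors nothing below `p = 2`
  is claimed.
* For the `K`-finite coefficients the decay `|⟨π_k(g) S_N, T_M⟩_k| ≤ C |a(g)|^{-k}` of
  `T5BergmanIntegrableKFinite` and the closed form `∫_G |a(g)|^{-s} dμ_R = 2/(s-2)` of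
  `T5BergmanCoefficientLpNorm` give the EXPLICIT bound
  `∫_G |⟨π_k(g) S_N, T_M⟩_k|^p dμ_R ≤ C^p · 2/(k p - 2)` for every `k p > 2`
  (`integral_norm_matrixCoeff_partialSum_partialSum_rpow_le`; `L¹` form for `k ≥ 3`).

Nothing is claimed about (N). Blind lane: Mathlib + the HodgeRepro2 prefix only; no sorry; axioms ⊆
{propext, Classical.choice, Quot.sound}.
-/

namespace Summit.Ventures.HodgeRepro2.T5BergmanCoefficientLpAll

open MeasureTheory MeasureTheory.Measure Metric Filter Topology Set Finset
open T5PoincareDensity T5PoincareMeasure T5SU11Unimodular T5U11Unimodular T5U11Product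
  T5SU11Fibration T5SU11FibrationHaar T5HaarCircle T5SU11CoefficientL2
open T5BergmanCoefficient T5BergmanPairing T5BergmanFourier T5BergmanParseval T5BergmanProjection
  T5BergmanActStable T5BergmanMatrixCoeff T5BergmanSchur T5BergmanSchurGeneral T5BergmanSchurHaar
  T5BergmanKTypeMatrix T5BergmanIntegrableCoeff T5BergmanIntegrableSharp T5BergmanU11
  T5BergmanSchurGeneralU11 T5BergmanIntegrableKFinite T5BergmanCoefficientLp
  T5BergmanIntegrableSharpU11 T5BergmanCoefficientLpNorm
open scoped Real ENNReal NNReal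

/-! ### A bounded square-integrable function is `L^p` for `p ≥ 2` -/

/-- If `‖F x‖ ≤ C` everywhere and `‖F‖² ∈ L¹(μ)`, then `‖F‖^p ∈ L¹(μ)` for every real `p ≥ 2`
(`‖F‖^p = ‖F‖^{p-2} ‖F‖² ≤ C^{p-2} ‖F‖²`). -/
theorem integrable_norm_rpow_of_bounded_of_sq {α : Type*} [MeasurableSpace α] {μ : Measure α}
    {F : α → ℂ} (hF : AEStronglyMeasurable F μ) {C : ℝ} (hC : ∀ x, ‖F x‖ ≤ C)
    (h2 : Integrable (fun x => ‖F x‖ ^ 2) μ) {p : ℝ} (hp : 2 ≤ p) :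
    Integrable (fun x => ‖F x‖ ^ p) μ := by
  refine (h2.const_mul (C ^ (p - 2))).mono' ?_ (Eventually.of_forall fun x => ?_)
  · exact (hF.norm.aemeasurable.pow_const p).aestronglyMeasurable
  · rw [Real.norm_eq_abs, abs_of_nonneg (Real.rpow_nonneg (norm_nonneg _) p)]
    have hsplit : ‖F x‖ ^ p = ‖F x‖ ^ (p - 2) * ‖F x‖ ^ 2 := by
      rw [← Real.rpow_two, ← Real.rpow_add' (norm_nonneg _) (ne_of_gt (by linarith))]
      congr 1
      ring
    rw [hsplit]
    have hp2 : 0 ≤ p - 2 := sub_nonneg.2 hp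
    gcongr
    exact hC x

/-! ### Explicit `L^p` norm bounds for the `K`-finite coefficients -/

/-- `C_{m,n} ≥ 0`. -/
lemma decayConst_nonneg (k m n : ℕ) : 0 ≤ decayConst k m n := by
  unfold decayConst
  exact Finset.sum_nonneg fun i _ => by positivity

/-- The decay constant of a pair of polynomials is non-negative. -/
lemma polyDecayConst_nonneg (k : ℕ) (a b : ℕ → ℂ) (N M : ℕ) : 0 ≤ polyDecayConst k a b N M := by
  unfold polyDecayConst
  refine Finset.sum_nonneg fun m _ => Finset.sum_nonneg fun n _ => ?_
  exact mul_nonneg (mul_nonneg (norm_nonneg _) (norm_nonneg _))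
    (mul_nonneg (decayConst_nonneg k m n) (monomialNormSq_pos k n).le)

/-- The pointwise bound raised to the power `p`:
`|⟨π_k(g) S_N, T_M⟩_k|^p ≤ C^p · |a(g)|^{-k p}`. -/
lemma norm_matrixCoeff_partialSum_partialSum_rpow_le (k : ℕ) (hk : 2 ≤ k) (a b : ℕ → ℂ) (N M : ℕ)
    {p : ℝ} (hp : 0 ≤ p) (g : SU11) :
    ‖matrixCoeff k (partialSum a N) (partialSum b M) g‖ ^ p ≤
      polyDecayConst k a b N M ^ p * ‖mat g 0 0‖⁻¹ ^ ((k : ℝ) * p) := by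
  have h1 := Real.rpow_le_rpow (norm_nonneg _)
    (norm_matrixCoeff_partialSum_partialSum_le k hk a b N M g) hp
  rw [Real.mul_rpow (polyDecayConst_nonneg k a b N M) (by positivity), ← Real.rpow_natCast _ k,
    ← Real.rpow_mul (by positivity)] at h1
  exact h1

variable [MeasurableSpace Circle] [BorelSpace Circle]

/-! ### Every matrix coefficient of `π_k` is `L^p` for `p ≥ 2` -/

/-- **Every matrix coefficient of `π_k` lies in `L^p(SU(1,1), μ)` for every real `p ≥ 2`** (`k ≥ 2`,
holomorphic `f, h ∈ A_k`, every Haar measure `μ`): bounded by `√(⟨f,f⟩_k ⟨h,h⟩_k)` and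
square-integrable. -/
theorem memLp_matrixCoeff_of_two_le (μ : Measure SU11) [IsHaarMeasure μ] (k : ℕ) (hk : 2 ≤ k)
    (f : ℂ → ℂ) (hf : DifferentiableOn ℂ f (ball 0 1))
    (hfint : IntegrableOn (fun w => ‖f w‖ ^ 2 * (1 - ‖w‖ ^ 2) ^ (k - 2)) (ball (0 : ℂ) 1))
    (h : ℂ → ℂ) (hh : DifferentiableOn ℂ h (ball 0 1))
    (hhint : IntegrableOn (fun w => ‖h w‖ ^ 2 * (1 - ‖w‖ ^ 2) ^ (k - 2)) (ball (0 : ℂ) 1))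
    {p : ℝ} (hp : 2 ≤ p) :
    MemLp (matrixCoeff k f h) (ENNReal.ofReal p) μ := by
  have hc := continuous_matrixCoeff_of_differentiableOn k hk f hf hfint h hh hhint
  rw [memLp_ofReal_iff_integrable_norm_rpow hc.aestronglyMeasurable (by linarith)]
  exact integrable_norm_rpow_of_bounded_of_sq hc.aestronglyMeasurable
    (fun g => norm_matrixCoeff_le k hk f h hf hfint hh.continuousOn hhint g)
    (integrable_norm_matrixCoeff_sq_haar μ k hk _ f hf (hasSum_taylor f hf) hfint _ h
      (hasSum_taylor h hh) hhint) hp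

/-- The `L²` case restated: every matrix coefficient is square-integrable against every Haar measure. -/
theorem memLp_two_matrixCoeff (μ : Measure SU11) [IsHaarMeasure μ] (k : ℕ) (hk : 2 ≤ k)
    (f : ℂ → ℂ) (hf : DifferentiableOn ℂ f (ball 0 1))
    (hfint : IntegrableOn (fun w => ‖f w‖ ^ 2 * (1 - ‖w‖ ^ 2) ^ (k - 2)) (ball (0 : ℂ) 1))
    (h : ℂ → ℂ) (hh : DifferentiableOn ℂ h (ball 0 1))
    (hhint : IntegrableOn (fun w => ‖h w‖ ^ 2 * (1 - ‖w‖ ^ 2) ^ (k - 2)) (ball (0 : ℂ) 1)) :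
    MemLp (matrixCoeff k f h) 2 μ := by
  have e := memLp_matrixCoeff_of_two_le μ k hk f hf hfint h hh hhint (p := 2) le_rfl
  rwa [ENNReal.ofReal_ofNat] at e

/-! ### The explicit `L^p` bounds, integrated -/

/-- **Explicit `L^p` bound for every `K`-finite coefficient**: for `k ≥ 2` and `k p > 2`,
`∫_G |⟨π_k(g) S_N, T_M⟩_k|^p dμ_R ≤ C(S_N, T_M)^p · 2/(k p - 2)`. -/
theorem integral_norm_matrixCoeff_partialSum_partialSum_rpow_le (k : ℕ) (hk : 2 ≤ k) (a b : ℕ → ℂ)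
    (N M : ℕ) {p : ℝ} (hp : 0 < p) (hkp : 2 < (k : ℝ) * p) :
    ∫ g, ‖matrixCoeff k (partialSum a N) (partialSum b M) g‖ ^ p ∂ruhl ≤
      polyDecayConst k a b N M ^ p * (2 / ((k : ℝ) * p - 2)) := by
  have hint : Integrable (fun g => ‖mat g 0 0‖⁻¹ ^ ((k : ℝ) * p)) ruhl :=
    integrable_norm_mat_inv_rpow ruhl hkp
  calc ∫ g, ‖matrixCoeff k (partialSum a N) (partialSum b M) g‖ ^ p ∂ruhl
      ≤ ∫ g, polyDecayConst k a b N M ^ p * ‖mat g 0 0‖⁻¹ ^ ((k : ℝ) * p) ∂ruhl := by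
        refine integral_mono_of_nonneg (Eventually.of_forall fun g => by positivity)
          (hint.const_mul _) (Eventually.of_forall fun g => ?_)
        exact norm_matrixCoeff_partialSum_partialSum_rpow_le k hk a b N M hp.le g
    _ = polyDecayConst k a b N M ^ p * (2 / ((k : ℝ) * p - 2)) := by
        rw [integral_const_mul, integral_norm_mat_inv_rpow_ruhl hkp]

/-- The `L¹` form for the integrable members `k ≥ 3`:
`∫_G |⟨π_k(g) S_N, T_M⟩_k| dμ_R ≤ C(S_N, T_M) · 2/(k - 2)`. -/
theorem integral_norm_matrixCoeff_partialSum_partialSum_le (k : ℕ) (hk : 3 ≤ k) (a b : ℕ → ℂ)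
    (N M : ℕ) :
    ∫ g, ‖matrixCoeff k (partialSum a N) (partialSum b M) g‖ ∂ruhl ≤
      polyDecayConst k a b N M * (2 / ((k : ℝ) - 2)) := by
  have hk3 : (3 : ℝ) ≤ k := by exact_mod_cast hk
  have h := integral_norm_matrixCoeff_partialSum_partialSum_rpow_le k (by omega) a b N M (p := 1)
    one_pos (by linarith)
  simp only [Real.rpow_one, mul_one] at h
  exact h

/-- The `L²` form: `∫_G |⟨π_k(g) S_N, T_M⟩_k|² dμ_R ≤ C(S_N, T_M)² / (k - 1)` (`k ≥ 2`). -/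
theorem integral_norm_matrixCoeff_partialSum_partialSum_sq_le (k : ℕ) (hk : 2 ≤ k) (a b : ℕ → ℂ)
    (N M : ℕ) :
    ∫ g, ‖matrixCoeff k (partialSum a N) (partialSum b M) g‖ ^ 2 ∂ruhl ≤
      polyDecayConst k a b N M ^ 2 / ((k : ℝ) - 1) := by
  have hk2 : (2 : ℝ) ≤ k := by exact_mod_cast hk
  have h := integral_norm_matrixCoeff_partialSum_partialSum_rpow_le k hk a b N M (p := 2)
    two_pos (by linarith)
  simp only [Real.rpow_two] at h
  refine h.trans (le_of_eq ?_)
  have hk1 : ((k : ℝ) - 1) ≠ 0 := by linarith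
  have hk2' : ((k : ℝ) * 2 - 2) ≠ 0 := by linarith
  field_simp

variable [MeasurableSpace U11] [BorelSpace U11]

/-- **On `H_j = U(1,1)`**: every matrix coefficient of `π_k` lies in `L^p(U(1,1), μ_U)` for every real
`p ≥ 2` and every Haar measure `μ_U`. -/
theorem memLp_matrixCoeffU_of_two_le (μU : Measure U11) [IsHaarMeasure μU] (k : ℕ) (hk : 2 ≤ k)
    (f : ℂ → ℂ) (hf : DifferentiableOn ℂ f (ball 0 1))
    (hfint : IntegrableOn (fun w => ‖f w‖ ^ 2 * (1 - ‖w‖ ^ 2) ^ (k - 2)) (ball (0 : ℂ) 1))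
    (h : ℂ → ℂ) (hh : DifferentiableOn ℂ h (ball 0 1))
    (hhint : IntegrableOn (fun w => ‖h w‖ ^ 2 * (1 - ‖w‖ ^ 2) ^ (k - 2)) (ball (0 : ℂ) 1))
    {p : ℝ} (hp : 2 ≤ p) :
    MemLp (matrixCoeffU k f h) (ENNReal.ofReal p) μU := by
  rw [memLp_matrixCoeffU_iff μU (nu haarCircle) k hk f hf hfint h hh hhint (by linarith)]
  exact memLp_matrixCoeff_of_two_le (nu haarCircle) k hk f hf hfint h hh hhint hp

end Summit.Ventures.HodgeRepro2.T5BergmanCoefficientLpAll
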